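import Mathlib
import Summits.Ventures.HodgeRepro.Tier4.Target
import Summits.Ventures.HodgeRepro.Tier4.Line3.KMDatum
import Summits.Ventures.HodgeRepro.Tier4.Line3.KMDatumS
import Summits.Ventures.HodgeRepro.Tier4.Line3.Defs
import Summits.Ventures.HodgeRepro.Tier4.Line3.DefsLemmas
import Summits.Ventures.HodgeRepro.Tier4.Line3.HeckeEquivarianceLemmas
import Summits.Ventures.HodgeRepro.Tier4.Line3.BallCoordLemmas

/-!
# Tier4/Line3/StabFinite — (R-c) of L3.6a: the stabiliser in `Γ′` of a line tuple is FINITE (Kronecker)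

Blind re-derivation cell `pub-hodge-repro`, Tier 4 «PROVE THE STEP» (README §9–§10), LINE L3, seat t4-L3-p2 (lead
S12616).  L3.6a (`term_main_unfold_of`, t4-L3-p1) displays `hfin : ∀ c : MainClass K xm, Finite (Stab K (mainRep K xm c))`,
`Stab K x` = `{γ // γ ∈ K.1 ∧ lines (γ • x) = lines x}` (an `abbrev`); proved here for every tuple whose first two
vectors are linearly independent, and for the main representatives of a symmetric tuple with independent first ball
coordinates (the `hab` clause of `HasLocaliser`).  PROOF, all rational (anisotropy `X.hAn` does everything): `γ ∈ Stab`
gives `γ x_j = s_j x_j` with `c(s_j) s_j = 1`; the Gram matrix of `(x₀, x₁)` is invertible, so an orthogonal `c ∉ span`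
exists, `(c, x₀, x₁)` is a basis and `γ c = s₂ c` with `c(s₂) s₂ = 1`; each `s_i` is an eigenvalue of the INTEGRAL
matrix `γ`, hence an algebraic integer with `‖φ s_i‖ = 1` at every embedding, so `γ ↦ (s₂, s₀, s₁)` is injective into
the cube of Kronecker's finite set `NumberField.Embeddings.finite_of_norm_le E′ ℂ 1`.

Nothing here says anything about the status of the Hodge conjecture for CM abelian varieties, which is NOT proved
(HC_CM is NOT proved by anyone in this repository).
-/

set_option autoImplicit false

noncomputable section

namespace Summit.Ventures.HodgeRepro.Tier4.Line3

open Summit.Ventures.HodgeRepro.Tier4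
open Matrix
open scoped ComplexConjugate

namespace T4Data

variable (X : T4Data)

/-! ## 1. The hermitian form: linearity, anisotropy -/

/-- `hform` is conjugate-linear in the first variable (scalars). -/
theorem hform_smul_left (a : X.E) (x y : Fin 3 → X.E) :
    hform X.c X.H (a • x) y = X.c a * hform X.c X.H x y := by
  unfold hform
  have h1 : (fun i => X.c ((a • x) i)) = X.c a • fun i => X.c (x i) := by
    funext i
    simp [map_mul]
  rw [h1, smul_dotProduct, smul_eq_mul]

/-- `hform` is linear in the second variable (scalars). -/
theorem hform_smul_right (b : X.E) (x y : Fin 3 → X.E) :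
    hform X.c X.H x (b • y) = b * hform X.c X.H x y := by
  unfold hform
  rw [Matrix.mulVec_smul, dotProduct_smul, smul_eq_mul]

/-- `hform` is additive in the second variable. -/
theorem hform_add_right (x y z : Fin 3 → X.E) :
    hform X.c X.H x (y + z) = hform X.c X.H x y + hform X.c X.H x z := by
  unfold hform
  rw [Matrix.mulVec_add, dotProduct_add]

/-- `hform` is additive in the first variable. -/
theorem hform_add_left (x y z : Fin 3 → X.E) :
    hform X.c X.H (x + y) z = hform X.c X.H x z + hform X.c X.H y z := by
  unfold hform
  have h1 : (fun i => X.c ((x + y) i)) = (fun i => X.c (x i)) + fun i => X.c (y i) := by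
    funext i
    simp [map_add]
  rw [h1, add_dotProduct]

/-- `hform` is subtractive in the second variable. -/
theorem hform_sub_right (x y z : Fin 3 → X.E) :
    hform X.c X.H x (y - z) = hform X.c X.H x y - hform X.c X.H x z := by
  unfold hform
  rw [Matrix.mulVec_sub, dotProduct_sub]

/-- `hform` of the zero vector (second variable). -/
theorem hform_zero_right (x : Fin 3 → X.E) : hform X.c X.H x 0 = 0 := by
  unfold hform
  rw [Matrix.mulVec_zero, dotProduct_zero]

/-- Anisotropy: a non-zero vector is not isotropic. -/
theorem hform_self_ne_zero {v : Fin 3 → X.E} (hv : v ≠ 0) : hform X.c X.H v v ≠ 0 :=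
  fun h => hv (X.hAn v h)

/-- A norm-one scalar is not zero. -/
theorem ne_zero_of_norm_one {t : X.E} (ht : X.c t * t = 1) : t ≠ 0 := by
  rintro rfl
  simp at ht

/-- `c t ≠ 0` for a norm-one scalar. -/
theorem c_ne_zero_of_norm_one {t : X.E} (ht : X.c t * t = 1) : X.c t ≠ 0 := by
  intro h
  rw [h, zero_mul] at ht
  exact zero_ne_one ht

/-- A norm-one scalar has absolute value `1` at every complex embedding. -/
theorem norm_emb_eq_one {t : X.E} (ht : X.c t * t = 1) (φ : X.E →+* ℂ) : ‖φ t‖ = 1 := by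
  have h1 : φ (X.c t) = conj (φ t) := NumberField.IsCMField.complexEmbedding_complexConj X.E φ t
  have h2 : conj (φ t) * φ t = 1 := by rw [← h1, ← map_mul, ht, map_one]
  rw [← Complex.normSq_eq_conj_mul_self, Complex.normSq_eq_norm_sq] at h2
  have h3 : ‖φ t‖ ^ 2 = 1 := by exact_mod_cast h2
  exact (pow_eq_one_iff_of_nonneg (norm_nonneg _) two_ne_zero).mp h3

/-! ## 2. The Gram matrix of two independent vectors and an orthogonal third vector -/

/-- The `2×2` Gram matrix of `(a, b)`: `G = !![⟨a,a⟩, ⟨a,b⟩; ⟨b,a⟩, ⟨b,b⟩]`. -/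
def gram2 (a b : Fin 3 → X.E) : Matrix (Fin 2) (Fin 2) X.E :=
  !![hform X.c X.H a a, hform X.c X.H a b; hform X.c X.H b a, hform X.c X.H b b]

/-- `G *ᵥ ![u, v] = (⟨a, u a + v b⟩, ⟨b, u a + v b⟩)`. -/
theorem gram2_mulVec (a b : Fin 3 → X.E) (u v : X.E) :
    X.gram2 a b *ᵥ ![u, v] = ![hform X.c X.H a (u • a + v • b), hform X.c X.H b (u • a + v • b)] := by
  funext i
  fin_cases i <;>
    simp [gram2, Matrix.mulVec, dotProduct, Fin.sum_univ_two, hform_add_right, hform_smul_right, mul_comm]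

/-- The Gram matrix of two independent vectors is invertible (anisotropy). -/
theorem det_gram2_ne_zero {a b : Fin 3 → X.E} (hab : LinearIndependent X.E ![a, b]) :
    (X.gram2 a b).det ≠ 0 := by
  intro hdet
  obtain ⟨w, hw0, hw⟩ := Matrix.exists_mulVec_eq_zero_iff.mpr hdet
  have hw' : X.gram2 a b *ᵥ ![w 0, w 1] = 0 := by
    have : ![w 0, w 1] = w := by
      funext i
      fin_cases i <;> rfl
    rw [this]
    exact hw
  rw [gram2_mulVec] at hw'
  have h0 : hform X.c X.H a (w 0 • a + w 1 • b) = 0 := by simpa using congrFun hw' 0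
  have h1 : hform X.c X.H b (w 0 • a + w 1 • b) = 0 := by simpa using congrFun hw' 1
  -- the vector `w 0 • a + w 1 • b` is isotropic, hence zero, hence `w = 0`
  have hiso : hform X.c X.H (w 0 • a + w 1 • b) (w 0 • a + w 1 • b) = 0 := by
    rw [hform_add_left, hform_smul_left, hform_smul_left, h0, h1, mul_zero, mul_zero, add_zero]
  have hzero : w 0 • a + w 1 • b = 0 := X.hAn _ hiso
  apply hw0
  have hli := hab
  rw [LinearIndependent.pair_iff] at hli
  obtain ⟨h0', h1'⟩ := hli (w 0) (w 1) hzero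
  funext i
  fin_cases i
  · exact h0'
  · exact h1'

/-- An orthogonal vector to a plane `span{a, b}` exists off the plane: for `e ∉ span{a, b}` the vector
`e − α a − β b` with `G (α, β) = (⟨a, e⟩, ⟨b, e⟩)`. -/
theorem exists_orth {a b : Fin 3 → X.E} (hab : LinearIndependent X.E ![a, b]) :
    ∃ c : Fin 3 → X.E, c ∉ Submodule.span X.E (Set.range ![a, b]) ∧
      hform X.c X.H a c = 0 ∧ hform X.c X.H b c = 0 := by
  -- a vector off the plane
  have hne : Submodule.span X.E (Set.range ![a, b]) ≠ ⊤ := by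
    intro htop
    have h1 : Module.finrank X.E (Submodule.span X.E (Set.range ![a, b])) ≤ 2 := by
      have := finrank_range_le_card (R := X.E) ![a, b]
      rwa [Fintype.card_fin] at this
    have h2 : Module.finrank X.E (Submodule.span X.E (Set.range ![a, b])) = 3 := by
      rw [htop, finrank_top, Module.finrank_fin_fun]
    omega
  obtain ⟨e, he⟩ : ∃ e, e ∉ Submodule.span X.E (Set.range ![a, b]) := by
    by_contra h
    apply hne
    rw [Submodule.eq_top_iff']
    intro x
    by_contra hx
    exact h ⟨x, hx⟩
  have hdet : IsUnit (X.gram2 a b).det := isUnit_iff_ne_zero.mpr (X.det_gram2_ne_zero hab)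
  set sol : Fin 2 → X.E := (X.gram2 a b)⁻¹ *ᵥ ![hform X.c X.H a e, hform X.c X.H b e] with hsol
  have hGsol : X.gram2 a b *ᵥ sol = ![hform X.c X.H a e, hform X.c X.H b e] := by
    rw [hsol, Matrix.mulVec_mulVec, Matrix.mul_nonsing_inv _ hdet, Matrix.one_mulVec]
  have hsol' : sol = ![sol 0, sol 1] := by
    funext i
    fin_cases i <;> rfl
  rw [hsol', gram2_mulVec] at hGsol
  refine ⟨e - (sol 0 • a + sol 1 • b), ?_, ?_, ?_⟩
  · intro hmem
    apply he
    have hin : sol 0 • a + sol 1 • b ∈ Submodule.span X.E (Set.range ![a, b]) := by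
      refine Submodule.add_mem _ (Submodule.smul_mem _ _ ?_) (Submodule.smul_mem _ _ ?_)
      · exact Submodule.subset_span ⟨0, rfl⟩
      · exact Submodule.subset_span ⟨1, rfl⟩
    have := Submodule.add_mem _ hmem hin
    simpa using this
  · have h0 : hform X.c X.H a (sol 0 • a + sol 1 • b) = hform X.c X.H a e := by
      have := congrFun hGsol 0
      simpa using this
    rw [hform_sub_right, h0, sub_self]
  · have h1 : hform X.c X.H b (sol 0 • a + sol 1 • b) = hform X.c X.H b e := by
      have := congrFun hGsol 1
      simpa using this
    rw [hform_sub_right, h1, sub_self]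

/-! ## 3. `(c, a, b)` is a basis -/

/-- `(c, a, b)` is linearly independent when `(a, b)` is and `c ∉ span{a, b}`. -/
theorem linearIndependent_cons {a b c : Fin 3 → X.E} (hab : LinearIndependent X.E ![a, b])
    (hc : c ∉ Submodule.span X.E (Set.range ![a, b])) : LinearIndependent X.E ![c, a, b] := by
  have h : (![c, a, b] : Fin 3 → Fin 3 → X.E) = Fin.cons c ![a, b] := rfl
  rw [h, linearIndependent_finCons]
  exact ⟨hab, hc⟩

/-- `(c, a, b)` spans `E′³`. -/
theorem span_eq_top_cons {a b c : Fin 3 → X.E} (hab : LinearIndependent X.E ![a, b])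
    (hc : c ∉ Submodule.span X.E (Set.range ![a, b])) :
    Submodule.span X.E (Set.range ![c, a, b]) = ⊤ :=
  (X.linearIndependent_cons hab hc).span_eq_top_of_card_eq_finrank
    (by rw [Fintype.card_fin, Module.finrank_fin_fun])

/-- Every vector is a combination `p • c + q • a + r • b`. -/
theorem exists_coords {a b c : Fin 3 → X.E} (hab : LinearIndependent X.E ![a, b])
    (hc : c ∉ Submodule.span X.E (Set.range ![a, b])) (v : Fin 3 → X.E) :
    ∃ p q r : X.E, v = p • c + q • a + r • b := by
  have hv : v ∈ Submodule.span X.E (Set.range ![c, a, b]) := by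
    rw [X.span_eq_top_cons hab hc]
    exact Submodule.mem_top
  rw [Submodule.mem_span_range_iff_exists_fun] at hv
  obtain ⟨f, hf⟩ := hv
  refine ⟨f 0, f 1, f 2, ?_⟩
  rw [← hf, Fin.sum_univ_three]
  simp

/-- A vector off `span{a, b}` is not zero. -/
theorem ne_zero_of_not_mem_span {a b c : Fin 3 → X.E}
    (hc : c ∉ Submodule.span X.E (Set.range ![a, b])) : c ≠ 0 := by
  rintro rfl
  exact hc (Submodule.zero_mem _)

/-! ## 4. The stabiliser: three eigen-scalars, norm one, integral -/

/-- From `lines (γ • x) = lines x`: `γ x_j` is a norm-one multiple of `x_j`. -/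
theorem exists_scalar_of_lines_eq {γ : Matrix (Fin 3) (Fin 3) X.E} {x : X.Tuple}
    (h : X.lines (fun j => γ *ᵥ x j) = X.lines x) (j : Fin 4) :
    ∃ s : X.E, X.c s * s = 1 ∧ γ *ᵥ x j = s • x j := by
  exact HeckeEquivariance.lineStep_symm X (HeckeEquivariance.lineStep_of_mk_eq X (congrFun h j))

/-- A unitary `γ` fixing the lines of independent `a, b` maps an orthogonal vector `c ∉ span{a, b}` to a norm-one
multiple of itself. -/
theorem exists_scalar_orth {γ : Matrix (Fin 3) (Fin 3) X.E} (hγ : IsUnitaryOf X.c X.H γ)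
    {a b c : Fin 3 → X.E} (hab : LinearIndependent X.E ![a, b])
    (hc : c ∉ Submodule.span X.E (Set.range ![a, b]))
    (hca : hform X.c X.H a c = 0) (hcb : hform X.c X.H b c = 0)
    {s₀ s₁ : X.E} (hs₀ : X.c s₀ * s₀ = 1) (hs₁ : X.c s₁ * s₁ = 1)
    (ha : γ *ᵥ a = s₀ • a) (hb : γ *ᵥ b = s₁ • b) :
    ∃ s₂ : X.E, X.c s₂ * s₂ = 1 ∧ γ *ᵥ c = s₂ • c := by
  have hga : hform X.c X.H a (γ *ᵥ c) = 0 := by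
    have h1 : hform X.c X.H (γ *ᵥ a) (γ *ᵥ c) = hform X.c X.H a c := X.hform_unitary hγ a c
    rw [ha, hform_smul_left, hca] at h1
    exact (mul_eq_zero.mp h1).resolve_left (X.c_ne_zero_of_norm_one hs₀)
  have hgb : hform X.c X.H b (γ *ᵥ c) = 0 := by
    have h1 : hform X.c X.H (γ *ᵥ b) (γ *ᵥ c) = hform X.c X.H b c := X.hform_unitary hγ b c
    rw [hb, hform_smul_left, hcb] at h1
    exact (mul_eq_zero.mp h1).resolve_left (X.c_ne_zero_of_norm_one hs₁)
  obtain ⟨p, q, r, hpqr⟩ := X.exists_coords hab hc (γ *ᵥ c)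
  have hG : X.gram2 a b *ᵥ ![q, r] = 0 := by
    rw [gram2_mulVec]
    have e1 : hform X.c X.H a (q • a + r • b) = 0 := by
      rw [hpqr, hform_add_right, hform_add_right, hform_smul_right, hca, mul_zero, zero_add] at hga
      rw [hform_add_right]
      exact hga
    have e2 : hform X.c X.H b (q • a + r • b) = 0 := by
      rw [hpqr, hform_add_right, hform_add_right, hform_smul_right, hcb, mul_zero, zero_add] at hgb
      rw [hform_add_right]
      exact hgb
    funext i
    fin_cases i
    · simpa using e1
    · simpa using e2
  have hqr : (![q, r] : Fin 2 → X.E) = 0 := Matrix.eq_zero_of_mulVec_eq_zero (X.det_gram2_ne_zero hab) hG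
  have hq : q = 0 := by simpa using congrFun hqr 0
  have hr : r = 0 := by simpa using congrFun hqr 1
  have hgc : γ *ᵥ c = p • c := by
    rw [hpqr, hq, hr, zero_smul, zero_smul, add_zero, add_zero]
  refine ⟨p, ?_, hgc⟩
  have h1 : hform X.c X.H (γ *ᵥ c) (γ *ᵥ c) = hform X.c X.H c c := X.hform_unitary hγ c c
  rw [hgc, X.hform_smul] at h1
  have hcc : hform X.c X.H c c ≠ 0 := X.hform_self_ne_zero (X.ne_zero_of_not_mem_span hc)
  have h2 : (X.c p * p - 1) * hform X.c X.H c c = 0 := by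
    rw [sub_mul, h1, one_mul, sub_self]
  exact sub_eq_zero.mp ((mul_eq_zero.mp h2).resolve_right hcc)

/-- An eigenvalue of a matrix with algebraic-integer entries is an algebraic integer. -/
theorem isIntegral_eigenvalue {γ : Matrix (Fin 3) (Fin 3) X.E} (hγ : IsIntegralMatrix γ)
    {s : X.E} {v : Fin 3 → X.E} (hv : v ≠ 0) (hs : γ *ᵥ v = s • v) : IsIntegral ℤ s := by
  have hdet : (Matrix.scalar (Fin 3) s - γ).det = 0 := by
    rw [← Matrix.exists_mulVec_eq_zero_iff]
    refine ⟨v, hv, ?_⟩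
    rw [Matrix.sub_mulVec, hs]
    funext i
    simp [Matrix.scalar_apply]
  let γ₀ : Matrix (Fin 3) (Fin 3) (NumberField.RingOfIntegers X.E) :=
    fun i j => ⟨γ i j, (mem_integralClosure_iff ℤ X.E).mpr (hγ i j)⟩
  have hmap : γ₀.map (algebraMap (NumberField.RingOfIntegers X.E) X.E) = γ := by
    ext i j
    rfl
  have hint : IsIntegral (NumberField.RingOfIntegers X.E) s := by
    refine ⟨γ₀.charpoly, Matrix.charpoly_monic γ₀, ?_⟩
    rw [Polynomial.eval₂_eq_eval_map, ← Matrix.charpoly_map, hmap, Matrix.eval_charpoly]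
    exact hdet
  exact isIntegral_trans s hint

/-! ## 5. Finiteness of the stabiliser (Kronecker) -/

/-- Kronecker's finite set: the algebraic integers of `E′` all of whose complex embeddings have absolute value `≤ 1`. -/
def kron : Set X.E := {x : X.E | IsIntegral ℤ x ∧ ∀ φ : X.E →+* ℂ, ‖φ x‖ ≤ 1}

/-- Kronecker's set is finite (`NumberField.Embeddings.finite_of_norm_le`). -/
theorem kron_finite : X.kron.Finite := NumberField.Embeddings.finite_of_norm_le X.E ℂ 1

/-- A norm-one eigenvalue of an integral matrix lies in Kronecker's set. -/
theorem mem_kron_of_eigen {γ : Matrix (Fin 3) (Fin 3) X.E} (hγ : IsIntegralMatrix γ) {s : X.E}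
    (hs : X.c s * s = 1) {v : Fin 3 → X.E} (hv : v ≠ 0) (h : γ *ᵥ v = s • v) : s ∈ X.kron :=
  ⟨X.isIntegral_eigenvalue hγ hv h, fun φ => le_of_eq (X.norm_emb_eq_one hs φ)⟩

/-- **(R-c) THE STABILISER OF A LINE TUPLE IS FINITE**: for a tuple whose first two vectors are linearly independent,
the elements of the level `Γ′ = K.1` fixing every line of the tuple form a finite set — `γ ↦ (s₂, s₀, s₁)`, the
eigen-scalars on `(c, x₀, x₁)`, is injective into the cube of Kronecker's finite set.  (The subtype is t4-L3-p1's
`Stab K x`, an `abbrev`.) -/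
theorem finite_lineStab (K : X.Level) (x : X.Tuple) (hx : LinearIndependent X.E ![x 0, x 1]) :
    Finite {γ : Matrix (Fin 3) (Fin 3) X.E // γ ∈ K.1 ∧ X.lines (fun j => γ *ᵥ x j) = X.lines x} := by
  obtain ⟨c, hc, hca, hcb⟩ := X.exists_orth hx
  have hx0 : x 0 ≠ 0 := by simpa using hx.ne_zero 0
  have hx1 : x 1 ≠ 0 := by simpa using hx.ne_zero 1
  have key : ∀ γ : {γ : Matrix (Fin 3) (Fin 3) X.E // γ ∈ K.1 ∧ X.lines (fun j => γ *ᵥ x j) = X.lines x},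
      ∃ s : Fin 3 → X.E, (∀ i, s i ∈ X.kron) ∧ γ.1 *ᵥ c = s 0 • c ∧ γ.1 *ᵥ x 0 = s 1 • x 0 ∧
        γ.1 *ᵥ x 1 = s 2 • x 1 := by
    intro γ
    obtain ⟨hγK, hγl⟩ := γ.2
    have hU : IsUnitaryOf X.c X.H γ.1 := HeckeEquivariance.isUnitaryOf_of_mem_level X K hγK
    have hI : IsIntegralMatrix γ.1 := (K.2.1.2.2.2.1 hγK).2.1
    obtain ⟨s₀, hs₀, h0⟩ := X.exists_scalar_of_lines_eq hγl 0
    obtain ⟨s₁, hs₁, h1⟩ := X.exists_scalar_of_lines_eq hγl 1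
    obtain ⟨s₂, hs₂, h2⟩ := X.exists_scalar_orth hU hx hc hca hcb hs₀ hs₁ h0 h1
    refine ⟨![s₂, s₀, s₁], ?_, by simpa using h2, by simpa using h0, by simpa using h1⟩
    intro i
    fin_cases i
    · exact X.mem_kron_of_eigen hI hs₂ (X.ne_zero_of_not_mem_span hc) h2
    · exact X.mem_kron_of_eigen hI hs₀ hx0 h0
    · exact X.mem_kron_of_eigen hI hs₁ hx1 h1
  choose s hs using key
  haveI : Finite X.kron := X.kron_finite.to_subtype
  refine Finite.of_injective (fun γ => fun i => (⟨s γ i, (hs γ).1 i⟩ : X.kron)) ?_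
  intro γ γ' h
  have hs_eq : s γ = s γ' := by
    funext i
    exact congrArg Subtype.val (congrFun h i)
  apply Subtype.ext
  apply Matrix.mulVec_injective
  funext v
  obtain ⟨p, q, r, hv⟩ := X.exists_coords hx hc v
  obtain ⟨-, e0, e1, e2⟩ := hs γ
  obtain ⟨-, f0, f1, f2⟩ := hs γ'
  rw [hv, Matrix.mulVec_add, Matrix.mulVec_add, Matrix.mulVec_smul, Matrix.mulVec_smul, Matrix.mulVec_smul,
    e0, e1, e2, Matrix.mulVec_add, Matrix.mulVec_add, Matrix.mulVec_smul, Matrix.mulVec_smul,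
    Matrix.mulVec_smul, f0, f1, f2, hs_eq]

/-! ## 6. The main-class representatives of a symmetric tuple -/

/-- `gRep K xm c` is a unit (a unitary matrix, or `1`). -/
theorem isUnit_gRep (K : X.Level) (xm : X.Tuple) (c : X.MainClass K xm) : IsUnit (X.gRep K xm c) := by
  unfold T4Data.gRep
  split_ifs with h
  · have hU : IsUnitaryOf X.c X.H (Classical.choose h) := (Classical.choose_spec h).1
    exact (Matrix.isUnit_iff_isUnit_det _).mpr (HeckeEquivariance.isUnit_det_of_isUnitaryOf X hU)
  · exact isUnit_one

/-- Linear independence is preserved by a unit matrix. -/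
theorem linearIndependent_mulVec {g : Matrix (Fin 3) (Fin 3) X.E} (hg : IsUnit g) {a b : Fin 3 → X.E}
    (hab : LinearIndependent X.E ![a, b]) : LinearIndependent X.E ![g *ᵥ a, g *ᵥ b] := by
  have hinj : Function.Injective g.mulVec := Matrix.mulVec_injective_iff_isUnit.mpr hg
  have h : (![g *ᵥ a, g *ᵥ b] : Fin 2 → Fin 3 → X.E) = (Matrix.mulVecLin g) ∘ ![a, b] := by
    funext i
    fin_cases i <;> rfl
  rw [h]
  exact hab.map' _ (LinearMap.ker_eq_bot.mpr hinj)

/-- **(R-c) FOR THE MAIN CLASSES**: for a symmetric tuple `xm` with independent first ball coordinates (the `hab`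
clause of `HasLocaliser`), the stabiliser in `Γ′` of the line tuple of every main-class representative
`mainRep K xm c = gRep • xm` is finite — `term_main_unfold_of`'s hypothesis `hfin`, verbatim (`Stab` is an `abbrev`). -/
theorem finite_lineStab_mainRep (K : X.Level) (xm : X.Tuple)
    (hab : X.ballCoord (xm 0) 0 * X.ballCoord (xm 1) 1 - X.ballCoord (xm 0) 1 * X.ballCoord (xm 1) 0 ≠ 0)
    (c : X.MainClass K xm) :
    Finite {γ : Matrix (Fin 3) (Fin 3) X.E //
      γ ∈ K.1 ∧ X.lines (fun j => γ *ᵥ X.mainRep K xm c j) = X.lines (X.mainRep K xm c)} := by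
  have h01 : LinearIndependent X.E ![xm 0, xm 1] := X.linearIndependent_of_ballWedge hab
  have hli : LinearIndependent X.E ![X.mainRep K xm c 0, X.mainRep K xm c 1] :=
    X.linearIndependent_mulVec (X.isUnit_gRep K xm c) h01
  exact X.finite_lineStab K (X.mainRep K xm c) hli

end T4Data

end Summit.Ventures.HodgeRepro.Tier4.Line3

end
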